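import Mathlib

/-!
# Smith normal form of a nonsingular square matrix over a principal ideal domain

Tier-5 kernel support (blind cell pub-hodge-repro2, seat p8, gen 11).

The «stays prose» cell of CHECK-N3 §17.1 row 5 / §18.1 row 1 — *the double-coset condition
for the specific `K` (the Cartan decomposition, or the transpose for `GL_n`)* — rests on the
elementary divisor theorem: every `g ∈ M_n(𝒪)` with `det g ≠ 0` factors as `g = P · diag(a) · Q`
with `P, Q ∈ GL_n(𝒪)`. This file proves that factorisation for an arbitrary principal ideal
domain `R` (the valuation ring `𝒪_v` of the record is one), from Mathlib's Smith normal form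
of a full-rank submodule of a free module (`Submodule.exists_smith_normal_form_of_rank_eq`):

* `mulVec_injective_of_det_ne_zero` — `det g ≠ 0` over a domain ⇒ `g.mulVec` is injective;
* `exists_smith` — **the factorisation** `g = P * diagonal a * Q` with `IsUnit P`, `IsUnit Q`;
* `exists_smith_ne_zero` — the same with every diagonal entry non-zero;
* `exists_smith_units` — the same with `P`, `Q` given as elements of `GL ι R`.

No measure, no topology, no representation theory: pure module theory over a PID.
Hypotheses as stated in the kernel: `R` a commutative domain with `IsPrincipalIdealRing R`;
`ι` a finite type with decidable equality (the matrix index set).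
-/

namespace Summit.Ventures.HodgeRepro2.T5SmithNonsingular

open Matrix

variable {R : Type*} [CommRing R] [IsDomain R]
variable {ι : Type*} [Fintype ι] [DecidableEq ι]

/-- Over a domain, a square matrix with non-zero determinant acts injectively on column
vectors: `adjugate g * g = det g • 1` cancels the determinant. -/
theorem mulVec_injective_of_det_ne_zero (g : Matrix ι ι R) (hg : g.det ≠ 0) :
    Function.Injective g.mulVec := by
  intro v w hvw
  have h1 : (g.adjugate * g).mulVec v = (g.adjugate * g).mulVec w := by
    rw [← Matrix.mulVec_mulVec, hvw, Matrix.mulVec_mulVec]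
  rw [Matrix.adjugate_mul] at h1
  funext i
  have h2 := congrFun h1 i
  simp only [Matrix.smul_mulVec, Matrix.one_mulVec, Pi.smul_apply, smul_eq_mul] at h2
  exact mul_left_cancel₀ hg h2

omit [IsDomain R] in
/-- The `j`-th column of `g` as an element of the column space `range (toLin' g)`. -/
theorem mulVec_single_mem_range (g : Matrix ι ι R) (j : ι) :
    g.mulVec (Pi.single j 1) ∈ LinearMap.range (Matrix.toLin' g) :=
  ⟨Pi.single j 1, Matrix.toLin'_apply g _⟩

variable [IsPrincipalIdealRing R]

/-- **Smith normal form of a nonsingular square matrix over a PID.** If `det g ≠ 0` then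
`g = P * diagonal a * Q` with `P` and `Q` invertible over `R`. Proof: the column space
`N = range (toLin' g)` has full rank (`g.mulVec` is injective), so Mathlib's Smith normal form
gives bases `b'` of `R^ι` and `ab'` of `N` with `ab' i = a i • b' i`; `P` is the matrix of
`b'` in the standard basis and `Q` the matrix of the columns of `g` in the basis `ab'`. -/
theorem exists_smith (g : Matrix ι ι R) (hg : g.det ≠ 0) :
    ∃ (P Q : Matrix ι ι R) (a : ι → R), IsUnit P ∧ IsUnit Q ∧ g = P * diagonal a * Q := by
  classical
  set f : (ι → R) →ₗ[R] (ι → R) := Matrix.toLin' g with hf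
  have hinj : Function.Injective f := by
    intro v w h
    exact mulVec_injective_of_det_ne_zero g hg (by simpa [hf, Matrix.toLin'_apply] using h)
  set N : Submodule R (ι → R) := LinearMap.range f with hN
  have hrank : Module.finrank R N = Module.finrank R (ι → R) :=
    LinearMap.finrank_range_of_inj hinj
  obtain ⟨b', a, ab', hab⟩ :=
    Submodule.exists_smith_normal_form_of_rank_eq (Pi.basisFun R ι) hrank
  -- the columns of `g` form a basis of `N`
  let e : (ι → R) ≃ₗ[R] N := LinearEquiv.ofInjective f hinj
  let bc : Module.Basis ι R N := (Pi.basisFun R ι).map e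
  have hbc : ∀ j, (bc j : ι → R) = g.mulVec (Pi.single j 1) := by
    intro j
    rw [Module.Basis.map_apply, LinearEquiv.ofInjective_apply, Pi.basisFun_apply, hf,
      Matrix.toLin'_apply]
  refine ⟨(Pi.basisFun R ι).toMatrix b', ab'.toMatrix bc, a, ?_, ?_, ?_⟩
  · exact @isUnit_of_invertible _ _ _ (Module.Basis.invertibleToMatrix _ _)
  · exact @isUnit_of_invertible _ _ _ (Module.Basis.invertibleToMatrix _ _)
  · ext l j
    -- expand the `j`-th column of `g` in the basis `ab'`
    have hsum : (bc j : ι → R) = ∑ i, ab'.toMatrix bc i j • (a i • b' i) := by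
      conv_lhs => rw [← ab'.sum_repr (bc j)]
      rw [Submodule.coe_sum]
      refine Finset.sum_congr rfl fun i _ => ?_
      rw [Submodule.coe_smul, hab, Module.Basis.toMatrix_apply]
    have hl := congrFun hsum l
    rw [hbc] at hl
    have hgl : g.mulVec (Pi.single j 1) l = g l j := by
      simp
    rw [hgl] at hl
    rw [hl, Matrix.mul_apply]
    simp only [Finset.sum_apply, Pi.smul_apply, smul_eq_mul, Matrix.mul_diagonal,
      Module.Basis.toMatrix_apply, Pi.basisFun_repr]
    refine Finset.sum_congr rfl fun i _ => ?_
    ring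

/-- The Smith factorisation with every diagonal entry non-zero (`det g ≠ 0` forces it). -/
theorem exists_smith_ne_zero (g : Matrix ι ι R) (hg : g.det ≠ 0) :
    ∃ (P Q : Matrix ι ι R) (a : ι → R),
      IsUnit P ∧ IsUnit Q ∧ (∀ i, a i ≠ 0) ∧ g = P * diagonal a * Q := by
  obtain ⟨P, Q, a, hP, hQ, hg'⟩ := exists_smith g hg
  refine ⟨P, Q, a, hP, hQ, ?_, hg'⟩
  intro i hi
  apply hg
  rw [hg', Matrix.det_mul, Matrix.det_mul, Matrix.det_diagonal]
  have : ∏ k, a k = 0 := Finset.prod_eq_zero (Finset.mem_univ i) hi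
  rw [this, mul_zero, zero_mul]

/-- The Smith factorisation with `P`, `Q` as elements of the general linear group `GL ι R`. -/
theorem exists_smith_units (g : Matrix ι ι R) (hg : g.det ≠ 0) :
    ∃ (P Q : GL ι R) (a : ι → R),
      (∀ i, a i ≠ 0) ∧ g = (P : Matrix ι ι R) * diagonal a * (Q : Matrix ι ι R) := by
  obtain ⟨P, Q, a, hP, hQ, ha, hg'⟩ := exists_smith_ne_zero g hg
  exact ⟨hP.unit, hQ.unit, a, ha, by simpa using hg'⟩

end Summit.Ventures.HodgeRepro2.T5SmithNonsingular
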